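import Literature.NumberTheory.EllipticCurves.WeierstrassAddLawTwoProportional
import HarnessLib

/-!
# The third minor of the two addition laws vanishes on `E × E`

Complement to `EllipticCurves/WeierstrassAddLawTwoProportional`: the remaining `2 × 2` minor
`add₂X · addY − add₂Y · addX` of the second addition law `add₂XYZ` against Mathlib's `addXYZ` also
vanishes for point representatives on the curve, **unconditionally** (the sibling file derives it only
where `addZ` is a non-zero-divisor). With all three minors, wherever both laws are non-zero at a pair
of field-valued points they are proportional by a unit, including the case `addZ = add₂Z = 0`
(the sum is `O`). Kernel-checked `linear_combination` certificate found by computer algebra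
(Bosma–Lenstra 1995, Theorem 2: both laws lie in the same three-dimensional space of bidegree
`(2, 2)` addition laws).

## References

* [BosmaLenstra1995] W. Bosma, H. W. Lenstra, J. Number Theory 53 (1995), 229–240: Theorem 2.
-/

local notation3 "x" => (0 : Fin 3)

local notation3 "y" => (1 : Fin 3)

local notation3 "z" => (2 : Fin 3)

universe r

namespace WeierstrassCurve.Projective

variable {R : Type r} [CommRing R] {W' : Projective R}

set_option maxHeartbeats 6400000 in
set_option maxRecDepth 32000 in
-- polynomial identity with several thousand monomials (kernel-checked certificate)
/-- **The minor `add₂X · addY − add₂Y · addX` vanishes on `E × E`.** [cite: BosmaLenstra1995, Theorem 2] -/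
theorem add₂X_mul_addY' {P Q : Fin 3 → R} (hP : W'.Equation P) (hQ : W'.Equation Q) :
    W'.add₂X P Q * W'.addY P Q = W'.add₂Y P Q * W'.addX P Q := by
  linear_combination (norm := (rw [add₂X, add₂Y, addY, negY_eq, negAddY, addX, addZ]; ring1))
    (-3 * P y * Q x * Q y ^ 3 + 9 * W'.a₆ * P z * Q x * Q y ^ 2 * Q z
      - 9 * W'.a₆ * P y * Q x * Q y * Q z ^ 2 + 27 * W'.a₆ ^ 2 * P z * Q x * Q z ^ 3
      + 3 * W'.a₄ * P z * Q x ^ 2 * Q y ^ 2 - 3 * W'.a₄ * P y * Q x ^ 2 * Q y * Q z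
      + 3 * W'.a₄ * P x * Q x * Q y ^ 2 * Q z + 18 * W'.a₄ * W'.a₆ * P z * Q x ^ 2 * Q z ^ 2
      + 9 * W'.a₄ * W'.a₆ * P x * Q x * Q z ^ 3 + 3 * W'.a₄ ^ 2 * P z * Q y ^ 2 * Q z ^ 2
      + W'.a₄ ^ 2 * P y * Q y * Q z ^ 3 + 3 * W'.a₄ ^ 2 * P x * Q x ^ 2 * Q z ^ 2
      - 6 * W'.a₄ ^ 2 * W'.a₆ * P z * Q z ^ 4 - 4 * W'.a₄ ^ 3 * P z * Q x * Q z ^ 3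
      - W'.a₄ ^ 3 * P x * Q z ^ 4 - 3 * W'.a₃ * P y * Q x * Q y ^ 2 * Q z
      + 9 * W'.a₃ * W'.a₆ * P z * Q x * Q y * Q z ^ 2
      + 3 * W'.a₃ * W'.a₄ * P z * Q x ^ 2 * Q y * Q z
      + 3 * W'.a₃ * W'.a₄ * P x * Q x * Q y * Q z ^ 2 + 3 * W'.a₃ * W'.a₄ ^ 2 * P z * Q y * Q z ^ 3
      + 3 * W'.a₃ ^ 2 * P z * Q x * Q y ^ 2 * Q z - 3 * W'.a₃ ^ 2 * P y * Q x * Q y * Q z ^ 2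
      + 18 * W'.a₃ ^ 2 * W'.a₆ * P z * Q x * Q z ^ 3
      + 6 * W'.a₃ ^ 2 * W'.a₄ * P z * Q x ^ 2 * Q z ^ 2
      + 3 * W'.a₃ ^ 2 * W'.a₄ * P x * Q x * Q z ^ 3 - W'.a₃ ^ 2 * W'.a₄ ^ 2 * P z * Q z ^ 4
      + 3 * W'.a₃ ^ 3 * P z * Q x * Q y * Q z ^ 2 + 3 * W'.a₃ ^ 4 * P z * Q x * Q z ^ 3
      - W'.a₂ * P y * Q y ^ 3 * Q z + 3 * W'.a₂ * P x * Q x ^ 2 * Q y ^ 2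
      + 3 * W'.a₂ * W'.a₆ * P z * Q y ^ 2 * Q z ^ 2 - 3 * W'.a₂ * W'.a₆ * P y * Q y * Q z ^ 3
      + 9 * W'.a₂ * W'.a₆ * P x * Q x ^ 2 * Q z ^ 2 + 9 * W'.a₂ * W'.a₆ ^ 2 * P z * Q z ^ 4
      + 4 * W'.a₂ * W'.a₄ * P z * Q x * Q y ^ 2 * Q z - 3 * W'.a₂ * W'.a₄ * P z * Q x ^ 4
      + W'.a₂ * W'.a₄ * P y * Q x * Q y * Q z ^ 2 + W'.a₂ * W'.a₄ * P x * Q y ^ 2 * Q z ^ 2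
      + 3 * W'.a₂ * W'.a₄ * P x * Q x ^ 3 * Q z - 3 * W'.a₂ * W'.a₄ * W'.a₆ * P z * Q x * Q z ^ 3
      + 3 * W'.a₂ * W'.a₄ * W'.a₆ * P x * Q z ^ 4 - 7 * W'.a₂ * W'.a₄ ^ 2 * P z * Q x ^ 2 * Q z ^ 2
      - 2 * W'.a₂ * W'.a₄ ^ 2 * P x * Q x * Q z ^ 3 - W'.a₂ * W'.a₃ * P y * Q y ^ 2 * Q z ^ 2
      + 3 * W'.a₂ * W'.a₃ * P x * Q x ^ 2 * Q y * Q z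
      + 3 * W'.a₂ * W'.a₃ * W'.a₆ * P z * Q y * Q z ^ 3
      + 4 * W'.a₂ * W'.a₃ * W'.a₄ * P z * Q x * Q y * Q z ^ 2
      + W'.a₂ * W'.a₃ * W'.a₄ * P x * Q y * Q z ^ 3 + W'.a₂ * W'.a₃ ^ 2 * P z * Q y ^ 2 * Q z ^ 2
      - W'.a₂ * W'.a₃ ^ 2 * P y * Q y * Q z ^ 3 + 3 * W'.a₂ * W'.a₃ ^ 2 * P x * Q x ^ 2 * Q z ^ 2
      + 6 * W'.a₂ * W'.a₃ ^ 2 * W'.a₆ * P z * Q z ^ 4 + W'.a₂ * W'.a₃ ^ 2 * W'.a₄ * P x * Q z ^ 4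
      + W'.a₂ * W'.a₃ ^ 3 * P z * Q y * Q z ^ 3 + W'.a₂ * W'.a₃ ^ 4 * P z * Q z ^ 4
      + W'.a₂ ^ 2 * P y * Q x ^ 2 * Q y * Q z + W'.a₂ ^ 2 * P x * Q x * Q y ^ 2 * Q z
      - 3 * W'.a₂ ^ 2 * W'.a₆ * P z * Q x ^ 2 * Q z ^ 2
      + 3 * W'.a₂ ^ 2 * W'.a₆ * P x * Q x * Q z ^ 3 - W'.a₂ ^ 2 * W'.a₄ * P z * Q y ^ 2 * Q z ^ 2
      - 3 * W'.a₂ ^ 2 * W'.a₄ * P z * Q x ^ 3 * Q z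
      - 2 * W'.a₂ ^ 2 * W'.a₄ * P x * Q x ^ 2 * Q z ^ 2 + W'.a₂ ^ 2 * W'.a₄ * W'.a₆ * P z * Q z ^ 4
      + W'.a₂ ^ 2 * W'.a₄ ^ 2 * P z * Q x * Q z ^ 3 + W'.a₂ ^ 2 * W'.a₃ * P x * Q x * Q y * Q z ^ 2
      - W'.a₂ ^ 2 * W'.a₃ * W'.a₄ * P z * Q y * Q z ^ 3
      - W'.a₂ ^ 2 * W'.a₃ ^ 2 * P z * Q x ^ 2 * Q z ^ 2
      + W'.a₂ ^ 2 * W'.a₃ ^ 2 * P x * Q x * Q z ^ 3 - W'.a₂ ^ 3 * P z * Q x * Q y ^ 2 * Q z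
      + W'.a₂ ^ 3 * P z * Q x ^ 4 - W'.a₂ ^ 3 * P x * Q x ^ 3 * Q z
      + W'.a₂ ^ 3 * W'.a₆ * P z * Q x * Q z ^ 3 + 2 * W'.a₂ ^ 3 * W'.a₄ * P z * Q x ^ 2 * Q z ^ 2
      - W'.a₂ ^ 3 * W'.a₃ * P z * Q x * Q y * Q z ^ 2 + W'.a₂ ^ 4 * P z * Q x ^ 3 * Q z
      - 3 * W'.a₁ * P y * Q x ^ 2 * Q y ^ 2 - 3 * W'.a₁ * P x * Q x * Q y ^ 3
      + 9 * W'.a₁ * W'.a₆ * P z * Q x ^ 2 * Q y * Q z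
      - 9 * W'.a₁ * W'.a₆ * P x * Q x * Q y * Q z ^ 2 - 3 * W'.a₁ * W'.a₄ * P z * Q y ^ 3 * Q z
      + 6 * W'.a₁ * W'.a₄ * P z * Q x ^ 3 * Q y + 3 * W'.a₁ * W'.a₄ * P y * Q y ^ 2 * Q z ^ 2
      - 3 * W'.a₁ * W'.a₄ * P y * Q x ^ 3 * Q z + 3 * W'.a₁ * W'.a₄ * W'.a₆ * P z * Q y * Q z ^ 3
      - 3 * W'.a₁ * W'.a₄ * W'.a₆ * P y * Q z ^ 4
      + 6 * W'.a₁ * W'.a₄ ^ 2 * P z * Q x * Q y * Q z ^ 2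
      - 3 * W'.a₁ * W'.a₄ ^ 2 * P y * Q x * Q z ^ 3 + W'.a₁ * W'.a₄ ^ 2 * P x * Q y * Q z ^ 3
      + 3 * W'.a₁ * W'.a₃ * P z * Q x ^ 2 * Q y ^ 2 - 3 * W'.a₁ * W'.a₃ * P y * Q x ^ 2 * Q y * Q z
      - 3 * W'.a₁ * W'.a₃ * P x * Q x * Q y ^ 2 * Q z
      + 18 * W'.a₁ * W'.a₃ * W'.a₆ * P z * Q x ^ 2 * Q z ^ 2
      + 3 * W'.a₁ * W'.a₃ * W'.a₄ * P z * Q x ^ 3 * Q z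
      + 4 * W'.a₁ * W'.a₃ * W'.a₄ * P y * Q y * Q z ^ 3
      + 3 * W'.a₁ * W'.a₃ * W'.a₄ * P x * Q x ^ 2 * Q z ^ 2
      - 6 * W'.a₁ * W'.a₃ * W'.a₄ * W'.a₆ * P z * Q z ^ 4
      - 5 * W'.a₁ * W'.a₃ * W'.a₄ ^ 2 * P z * Q x * Q z ^ 3
      - W'.a₁ * W'.a₃ * W'.a₄ ^ 2 * P x * Q z ^ 4
      + 6 * W'.a₁ * W'.a₃ ^ 2 * P z * Q x ^ 2 * Q y * Q z
      - 3 * W'.a₁ * W'.a₃ ^ 2 * P x * Q x * Q y * Q z ^ 2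
      + 3 * W'.a₁ * W'.a₃ ^ 2 * W'.a₄ * P z * Q y * Q z ^ 3
      + 6 * W'.a₁ * W'.a₃ ^ 3 * P z * Q x ^ 2 * Q z ^ 2 - W'.a₁ * W'.a₃ ^ 3 * W'.a₄ * P z * Q z ^ 4
      + 2 * W'.a₁ * W'.a₂ * P y * Q x * Q y ^ 2 * Q z - 3 * W'.a₁ * W'.a₂ * P y * Q x ^ 4
      - W'.a₁ * W'.a₂ * P x * Q y ^ 3 * Q z + 3 * W'.a₁ * W'.a₂ * P x * Q x ^ 3 * Q y
      + 3 * W'.a₁ * W'.a₂ * W'.a₆ * P z * Q x * Q y * Q z ^ 2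
      - 3 * W'.a₁ * W'.a₂ * W'.a₆ * P y * Q x * Q z ^ 3
      - 3 * W'.a₁ * W'.a₂ * W'.a₆ * P x * Q y * Q z ^ 3
      + 7 * W'.a₁ * W'.a₂ * W'.a₄ * P z * Q x ^ 2 * Q y * Q z
      - 6 * W'.a₁ * W'.a₂ * W'.a₄ * P y * Q x ^ 2 * Q z ^ 2
      + 2 * W'.a₁ * W'.a₂ * W'.a₄ * P x * Q x * Q y * Q z ^ 2
      + 4 * W'.a₁ * W'.a₂ * W'.a₃ * P z * Q x * Q y ^ 2 * Q z
      - 3 * W'.a₁ * W'.a₂ * W'.a₃ * P z * Q x ^ 4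
      + 3 * W'.a₁ * W'.a₂ * W'.a₃ * P y * Q x * Q y * Q z ^ 2
      - W'.a₁ * W'.a₂ * W'.a₃ * P x * Q y ^ 2 * Q z ^ 2
      + 3 * W'.a₁ * W'.a₂ * W'.a₃ * P x * Q x ^ 3 * Q z
      - 7 * W'.a₁ * W'.a₂ * W'.a₃ * W'.a₄ * P z * Q x ^ 2 * Q z ^ 2
      - W'.a₁ * W'.a₂ * W'.a₃ * W'.a₄ * P x * Q x * Q z ^ 3
      + 5 * W'.a₁ * W'.a₂ * W'.a₃ ^ 2 * P z * Q x * Q y * Q z ^ 2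
      - W'.a₁ * W'.a₂ * W'.a₃ ^ 2 * P x * Q y * Q z ^ 3
      + W'.a₁ * W'.a₂ * W'.a₃ ^ 3 * P z * Q x * Q z ^ 3 + W'.a₁ * W'.a₂ ^ 2 * P z * Q y ^ 3 * Q z
      - W'.a₁ * W'.a₂ ^ 2 * P z * Q x ^ 3 * Q y - 3 * W'.a₁ * W'.a₂ ^ 2 * P y * Q x ^ 3 * Q z
      + 2 * W'.a₁ * W'.a₂ ^ 2 * P x * Q x ^ 2 * Q y * Q z
      - W'.a₁ * W'.a₂ ^ 2 * W'.a₆ * P z * Q y * Q z ^ 3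
      - 2 * W'.a₁ * W'.a₂ ^ 2 * W'.a₄ * P z * Q x * Q y * Q z ^ 2
      + W'.a₁ * W'.a₂ ^ 2 * W'.a₃ * P z * Q y ^ 2 * Q z ^ 2
      - 4 * W'.a₁ * W'.a₂ ^ 2 * W'.a₃ * P z * Q x ^ 3 * Q z
      - 2 * W'.a₁ * W'.a₂ ^ 3 * P z * Q x ^ 2 * Q y * Q z - 4 * W'.a₁ ^ 2 * P y * Q y ^ 3 * Q z
      + 3 * W'.a₁ ^ 2 * P y * Q x ^ 3 * Q y - 3 * W'.a₁ ^ 2 * P x * Q x ^ 2 * Q y ^ 2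
      + 3 * W'.a₁ ^ 2 * W'.a₆ * P z * Q y ^ 2 * Q z ^ 2
      + 3 * W'.a₁ ^ 2 * W'.a₆ * P y * Q y * Q z ^ 3
      - 2 * W'.a₁ ^ 2 * W'.a₄ * P z * Q x * Q y ^ 2 * Q z
      + 7 * W'.a₁ ^ 2 * W'.a₄ * P y * Q x * Q y * Q z ^ 2
      + W'.a₁ ^ 2 * W'.a₄ * P x * Q y ^ 2 * Q z ^ 2
      - 3 * W'.a₁ ^ 2 * W'.a₄ * W'.a₆ * P z * Q x * Q z ^ 3
      - W'.a₁ ^ 2 * W'.a₄ ^ 2 * P z * Q x ^ 2 * Q z ^ 2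
      - W'.a₁ ^ 2 * W'.a₄ ^ 2 * P x * Q x * Q z ^ 3 - 3 * W'.a₁ ^ 2 * W'.a₃ * P z * Q y ^ 3 * Q z
      + 6 * W'.a₁ ^ 2 * W'.a₃ * P z * Q x ^ 3 * Q y
      - 4 * W'.a₁ ^ 2 * W'.a₃ * P y * Q y ^ 2 * Q z ^ 2
      - 3 * W'.a₁ ^ 2 * W'.a₃ * P x * Q x ^ 2 * Q y * Q z
      + 6 * W'.a₁ ^ 2 * W'.a₃ * W'.a₆ * P z * Q y * Q z ^ 3
      + 7 * W'.a₁ ^ 2 * W'.a₃ * W'.a₄ * P z * Q x * Q y * Q z ^ 2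
      + 2 * W'.a₁ ^ 2 * W'.a₃ * W'.a₄ * P x * Q y * Q z ^ 3
      - 2 * W'.a₁ ^ 2 * W'.a₃ ^ 2 * P z * Q y ^ 2 * Q z ^ 2
      + 3 * W'.a₁ ^ 2 * W'.a₃ ^ 2 * P z * Q x ^ 3 * Q z
      - 2 * W'.a₁ ^ 2 * W'.a₃ ^ 2 * W'.a₄ * P z * Q x * Q z ^ 3
      + W'.a₁ ^ 2 * W'.a₃ ^ 3 * P z * Q y * Q z ^ 3
      + 7 * W'.a₁ ^ 2 * W'.a₂ * P y * Q x ^ 2 * Q y * Q z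
      - 3 * W'.a₁ ^ 2 * W'.a₂ * W'.a₆ * P z * Q x ^ 2 * Q z ^ 2
      - W'.a₁ ^ 2 * W'.a₂ * W'.a₄ * P z * Q y ^ 2 * Q z ^ 2
      - 2 * W'.a₁ ^ 2 * W'.a₂ * W'.a₄ * P x * Q x ^ 2 * Q z ^ 2
      + W'.a₁ ^ 2 * W'.a₂ * W'.a₄ * W'.a₆ * P z * Q z ^ 4
      + W'.a₁ ^ 2 * W'.a₂ * W'.a₄ ^ 2 * P z * Q x * Q z ^ 3
      + 7 * W'.a₁ ^ 2 * W'.a₂ * W'.a₃ * P z * Q x ^ 2 * Q y * Q z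
      + W'.a₁ ^ 2 * W'.a₂ * W'.a₃ * P x * Q x * Q y * Q z ^ 2
      - W'.a₁ ^ 2 * W'.a₂ * W'.a₃ * W'.a₄ * P z * Q y * Q z ^ 3
      - W'.a₁ ^ 2 * W'.a₂ * W'.a₃ ^ 2 * P z * Q x ^ 2 * Q z ^ 2
      + W'.a₁ ^ 2 * W'.a₂ ^ 2 * P z * Q x ^ 4 - W'.a₁ ^ 2 * W'.a₂ ^ 2 * P x * Q x ^ 3 * Q z
      + W'.a₁ ^ 2 * W'.a₂ ^ 2 * W'.a₆ * P z * Q x * Q z ^ 3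
      + 2 * W'.a₁ ^ 2 * W'.a₂ ^ 2 * W'.a₄ * P z * Q x ^ 2 * Q z ^ 2
      - W'.a₁ ^ 2 * W'.a₂ ^ 2 * W'.a₃ * P z * Q x * Q y * Q z ^ 2
      + W'.a₁ ^ 2 * W'.a₂ ^ 3 * P z * Q x ^ 3 * Q z - 4 * W'.a₁ ^ 3 * P y * Q x * Q y ^ 2 * Q z
      - W'.a₁ ^ 3 * P x * Q y ^ 3 * Q z + 3 * W'.a₁ ^ 3 * W'.a₆ * P z * Q x * Q y * Q z ^ 2
      + W'.a₁ ^ 3 * W'.a₄ * P z * Q x ^ 2 * Q y * Q z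
      + 2 * W'.a₁ ^ 3 * W'.a₄ * P x * Q x * Q y * Q z ^ 2
      - 2 * W'.a₁ ^ 3 * W'.a₃ * P z * Q x * Q y ^ 2 * Q z
      - W'.a₁ ^ 3 * W'.a₃ * P x * Q y ^ 2 * Q z ^ 2
      - W'.a₁ ^ 3 * W'.a₃ * W'.a₄ * P z * Q x ^ 2 * Q z ^ 2
      + 2 * W'.a₁ ^ 3 * W'.a₃ ^ 2 * P z * Q x * Q y * Q z ^ 2
      + W'.a₁ ^ 3 * W'.a₂ * P z * Q y ^ 3 * Q z - W'.a₁ ^ 3 * W'.a₂ * P z * Q x ^ 3 * Q y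
      + 2 * W'.a₁ ^ 3 * W'.a₂ * P x * Q x ^ 2 * Q y * Q z
      - W'.a₁ ^ 3 * W'.a₂ * W'.a₆ * P z * Q y * Q z ^ 3
      - 2 * W'.a₁ ^ 3 * W'.a₂ * W'.a₄ * P z * Q x * Q y * Q z ^ 2
      + W'.a₁ ^ 3 * W'.a₂ * W'.a₃ * P z * Q y ^ 2 * Q z ^ 2
      - W'.a₁ ^ 3 * W'.a₂ * W'.a₃ * P z * Q x ^ 3 * Q z
      - 2 * W'.a₁ ^ 3 * W'.a₂ ^ 2 * P z * Q x ^ 2 * Q y * Q z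
      - W'.a₁ ^ 4 * P x * Q x * Q y ^ 2 * Q z + W'.a₁ ^ 4 * W'.a₃ * P z * Q x ^ 2 * Q y * Q z
      + W'.a₁ ^ 4 * W'.a₂ * P z * Q x * Q y ^ 2 * Q z) * (equation_iff P).mp hP
    + (3 * P x * P y ^ 3 * Q y + 9 * W'.a₆ * P x * P y * P z ^ 2 * Q y
      - 9 * W'.a₆ * P x * P y ^ 2 * P z * Q z - 27 * W'.a₆ ^ 2 * P x * P z ^ 3 * Q z
      - 3 * W'.a₄ * P x * P y ^ 2 * P z * Q x + 3 * W'.a₄ * P x ^ 2 * P y * P z * Q y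
      - 3 * W'.a₄ * P x ^ 2 * P y ^ 2 * Q z - 9 * W'.a₄ * W'.a₆ * P x * P z ^ 3 * Q x
      - 18 * W'.a₄ * W'.a₆ * P x ^ 2 * P z ^ 2 * Q z - W'.a₄ ^ 2 * P y * P z ^ 3 * Q y
      - 3 * W'.a₄ ^ 2 * P y ^ 2 * P z ^ 2 * Q z - 3 * W'.a₄ ^ 2 * P x ^ 2 * P z ^ 2 * Q x
      + 6 * W'.a₄ ^ 2 * W'.a₆ * P z ^ 4 * Q z + W'.a₄ ^ 3 * P z ^ 4 * Q x
      + 4 * W'.a₄ ^ 3 * P x * P z ^ 3 * Q z + 3 * W'.a₃ * P x * P y ^ 2 * P z * Q y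
      - 9 * W'.a₃ * W'.a₆ * P x * P y * P z ^ 2 * Q z
      - 3 * W'.a₃ * W'.a₄ * P x * P y * P z ^ 2 * Q x
      - 3 * W'.a₃ * W'.a₄ * P x ^ 2 * P y * P z * Q z - 3 * W'.a₃ * W'.a₄ ^ 2 * P y * P z ^ 3 * Q z
      + 3 * W'.a₃ ^ 2 * P x * P y * P z ^ 2 * Q y - 3 * W'.a₃ ^ 2 * P x * P y ^ 2 * P z * Q z
      - 18 * W'.a₃ ^ 2 * W'.a₆ * P x * P z ^ 3 * Q z - 3 * W'.a₃ ^ 2 * W'.a₄ * P x * P z ^ 3 * Q x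
      - 6 * W'.a₃ ^ 2 * W'.a₄ * P x ^ 2 * P z ^ 2 * Q z + W'.a₃ ^ 2 * W'.a₄ ^ 2 * P z ^ 4 * Q z
      - 3 * W'.a₃ ^ 3 * P x * P y * P z ^ 2 * Q z - 3 * W'.a₃ ^ 4 * P x * P z ^ 3 * Q z
      + W'.a₂ * P y ^ 3 * P z * Q y - 3 * W'.a₂ * P x ^ 2 * P y ^ 2 * Q x
      + 3 * W'.a₂ * W'.a₆ * P y * P z ^ 3 * Q y - 3 * W'.a₂ * W'.a₆ * P y ^ 2 * P z ^ 2 * Q z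
      - 9 * W'.a₂ * W'.a₆ * P x ^ 2 * P z ^ 2 * Q x - 9 * W'.a₂ * W'.a₆ ^ 2 * P z ^ 4 * Q z
      - 4 * W'.a₂ * W'.a₄ * P y ^ 2 * P z ^ 2 * Q x - W'.a₂ * W'.a₄ * P x * P y * P z ^ 2 * Q y
      - W'.a₂ * W'.a₄ * P x * P y ^ 2 * P z * Q z + 5 * W'.a₂ * W'.a₄ ^ 2 * P x * P z ^ 3 * Q x
      + 4 * W'.a₂ * W'.a₄ ^ 2 * P x ^ 2 * P z ^ 2 * Q z + W'.a₂ * W'.a₃ * P y ^ 2 * P z ^ 2 * Q y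
      - 3 * W'.a₂ * W'.a₃ * P x ^ 2 * P y * P z * Q x
      - 3 * W'.a₂ * W'.a₃ * W'.a₆ * P y * P z ^ 3 * Q z
      - 4 * W'.a₂ * W'.a₃ * W'.a₄ * P y * P z ^ 3 * Q x
      - W'.a₂ * W'.a₃ * W'.a₄ * P x * P y * P z ^ 2 * Q z + W'.a₂ * W'.a₃ ^ 2 * P y * P z ^ 3 * Q y
      - W'.a₂ * W'.a₃ ^ 2 * P y ^ 2 * P z ^ 2 * Q z
      - 3 * W'.a₂ * W'.a₃ ^ 2 * P x ^ 2 * P z ^ 2 * Q x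
      - 6 * W'.a₂ * W'.a₃ ^ 2 * W'.a₆ * P z ^ 4 * Q z - W'.a₂ * W'.a₃ ^ 2 * W'.a₄ * P z ^ 4 * Q x
      - W'.a₂ * W'.a₃ ^ 3 * P y * P z ^ 3 * Q z - W'.a₂ * W'.a₃ ^ 4 * P z ^ 4 * Q z
      - W'.a₂ ^ 2 * P x * P y ^ 2 * P z * Q x - W'.a₂ ^ 2 * P x ^ 2 * P y * P z * Q y
      - 3 * W'.a₂ ^ 2 * W'.a₆ * P x * P z ^ 3 * Q x
      + 3 * W'.a₂ ^ 2 * W'.a₆ * P x ^ 2 * P z ^ 2 * Q z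
      + W'.a₂ ^ 2 * W'.a₄ * P y ^ 2 * P z ^ 2 * Q z
      + 5 * W'.a₂ ^ 2 * W'.a₄ * P x ^ 2 * P z ^ 2 * Q x - W'.a₂ ^ 2 * W'.a₄ * W'.a₆ * P z ^ 4 * Q z
      - W'.a₂ ^ 2 * W'.a₄ ^ 2 * P x * P z ^ 3 * Q z - W'.a₂ ^ 2 * W'.a₃ * P x * P y * P z ^ 2 * Q x
      + W'.a₂ ^ 2 * W'.a₃ * W'.a₄ * P y * P z ^ 3 * Q z
      - W'.a₂ ^ 2 * W'.a₃ ^ 2 * P x * P z ^ 3 * Q x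
      + W'.a₂ ^ 2 * W'.a₃ ^ 2 * P x ^ 2 * P z ^ 2 * Q z + W'.a₂ ^ 3 * P y ^ 2 * P z ^ 2 * Q x
      - W'.a₂ ^ 3 * W'.a₆ * P z ^ 4 * Q x - W'.a₂ ^ 3 * W'.a₄ * P x * P z ^ 3 * Q x
      - W'.a₂ ^ 3 * W'.a₄ * P x ^ 2 * P z ^ 2 * Q z + W'.a₂ ^ 3 * W'.a₃ * P y * P z ^ 3 * Q x
      - W'.a₂ ^ 4 * P x ^ 2 * P z ^ 2 * Q x + 6 * W'.a₁ * P x ^ 2 * P y ^ 2 * Q y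
      + 9 * W'.a₁ * W'.a₆ * P x ^ 2 * P z ^ 2 * Q y - 9 * W'.a₁ * W'.a₆ * P x ^ 2 * P y * P z * Q z
      + 3 * W'.a₁ * W'.a₄ * P y ^ 2 * P z ^ 2 * Q y - 3 * W'.a₁ * W'.a₄ * P y ^ 3 * P z * Q z
      - 3 * W'.a₁ * W'.a₄ * P x ^ 2 * P y * P z * Q x - 3 * W'.a₁ * W'.a₄ * W'.a₆ * P z ^ 4 * Q y
      + 3 * W'.a₁ * W'.a₄ * W'.a₆ * P y * P z ^ 3 * Q z
      - 4 * W'.a₁ * W'.a₄ ^ 2 * P x * P z ^ 3 * Q y - 3 * W'.a₁ * W'.a₃ * P x * P y ^ 2 * P z * Q x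
      + 6 * W'.a₁ * W'.a₃ * P x ^ 2 * P y * P z * Q y
      - 9 * W'.a₁ * W'.a₃ * W'.a₆ * P x * P z ^ 3 * Q x
      - 9 * W'.a₁ * W'.a₃ * W'.a₆ * P x ^ 2 * P z ^ 2 * Q z
      + 2 * W'.a₁ * W'.a₃ * W'.a₄ * P y * P z ^ 3 * Q y
      - 6 * W'.a₁ * W'.a₃ * W'.a₄ * P y ^ 2 * P z ^ 2 * Q z
      - 6 * W'.a₁ * W'.a₃ * W'.a₄ * P x ^ 2 * P z ^ 2 * Q x
      + 6 * W'.a₁ * W'.a₃ * W'.a₄ * W'.a₆ * P z ^ 4 * Q z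
      + 2 * W'.a₁ * W'.a₃ * W'.a₄ ^ 2 * P z ^ 4 * Q x
      + 4 * W'.a₁ * W'.a₃ * W'.a₄ ^ 2 * P x * P z ^ 3 * Q z
      - 3 * W'.a₁ * W'.a₃ ^ 2 * P x * P y * P z ^ 2 * Q x
      + 3 * W'.a₁ * W'.a₃ ^ 2 * P x ^ 2 * P z ^ 2 * Q y
      - 3 * W'.a₁ * W'.a₃ ^ 2 * P x ^ 2 * P y * P z * Q z
      - 3 * W'.a₁ * W'.a₃ ^ 2 * W'.a₄ * P y * P z ^ 3 * Q z
      - 3 * W'.a₁ * W'.a₃ ^ 3 * P x * P z ^ 3 * Q x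
      - 3 * W'.a₁ * W'.a₃ ^ 3 * P x ^ 2 * P z ^ 2 * Q z + W'.a₁ * W'.a₃ ^ 3 * W'.a₄ * P z ^ 4 * Q z
      - 3 * W'.a₁ * W'.a₂ * P y ^ 3 * P z * Q x + 2 * W'.a₁ * W'.a₂ * P x * P y ^ 2 * P z * Q y
      + 3 * W'.a₁ * W'.a₂ * W'.a₆ * P y * P z ^ 3 * Q x
      + 3 * W'.a₁ * W'.a₂ * W'.a₆ * P x * P z ^ 3 * Q y
      - 3 * W'.a₁ * W'.a₂ * W'.a₆ * P x * P y * P z ^ 2 * Q z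
      - W'.a₁ * W'.a₂ * W'.a₄ * P x * P y * P z ^ 2 * Q x
      - 4 * W'.a₁ * W'.a₂ * W'.a₄ * P x ^ 2 * P z ^ 2 * Q y
      + 2 * W'.a₁ * W'.a₂ * W'.a₄ * P x ^ 2 * P y * P z * Q z
      - 7 * W'.a₁ * W'.a₂ * W'.a₃ * P y ^ 2 * P z ^ 2 * Q x
      + W'.a₁ * W'.a₂ * W'.a₃ * P x * P y * P z ^ 2 * Q y
      + 5 * W'.a₁ * W'.a₂ * W'.a₃ * W'.a₄ * P x * P z ^ 3 * Q x
      + 3 * W'.a₁ * W'.a₂ * W'.a₃ * W'.a₄ * P x ^ 2 * P z ^ 2 * Q z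
      - 4 * W'.a₁ * W'.a₂ * W'.a₃ ^ 2 * P y * P z ^ 3 * Q x
      + W'.a₁ * W'.a₂ * W'.a₃ ^ 2 * P x * P z ^ 3 * Q y
      - W'.a₁ * W'.a₂ * W'.a₃ ^ 2 * P x * P y * P z ^ 2 * Q z
      - W'.a₁ * W'.a₂ * W'.a₃ ^ 3 * P z ^ 4 * Q x - W'.a₁ * W'.a₂ ^ 2 * P y ^ 2 * P z ^ 2 * Q y
      + 2 * W'.a₁ * W'.a₂ ^ 2 * P x ^ 2 * P y * P z * Q x
      + W'.a₁ * W'.a₂ ^ 2 * W'.a₆ * P z ^ 4 * Q y + W'.a₁ * W'.a₂ ^ 2 * W'.a₄ * P x * P z ^ 3 * Q y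
      + W'.a₁ * W'.a₂ ^ 2 * W'.a₄ * P x * P y * P z ^ 2 * Q z
      - W'.a₁ * W'.a₂ ^ 2 * W'.a₃ * P y * P z ^ 3 * Q y
      + 4 * W'.a₁ * W'.a₂ ^ 2 * W'.a₃ * P x ^ 2 * P z ^ 2 * Q x
      + W'.a₁ * W'.a₂ ^ 3 * P x * P y * P z ^ 2 * Q x + W'.a₁ * W'.a₂ ^ 3 * P x ^ 2 * P z ^ 2 * Q y
      + 4 * W'.a₁ ^ 2 * P y ^ 3 * P z * Q y - 3 * W'.a₁ ^ 2 * W'.a₆ * P y * P z ^ 3 * Q y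
      - 3 * W'.a₁ ^ 2 * W'.a₆ * P y ^ 2 * P z ^ 2 * Q z
      - W'.a₁ ^ 2 * W'.a₄ * P y ^ 2 * P z ^ 2 * Q x - W'.a₁ ^ 2 * W'.a₄ * P x * P y * P z ^ 2 * Q y
      - 4 * W'.a₁ ^ 2 * W'.a₄ * P x * P y ^ 2 * P z * Q z
      + 3 * W'.a₁ ^ 2 * W'.a₄ * W'.a₆ * P x * P z ^ 3 * Q z
      + W'.a₁ ^ 2 * W'.a₄ ^ 2 * P x * P z ^ 3 * Q x
      + W'.a₁ ^ 2 * W'.a₄ ^ 2 * P x ^ 2 * P z ^ 2 * Q z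
      + 7 * W'.a₁ ^ 2 * W'.a₃ * P y ^ 2 * P z ^ 2 * Q y
      - 3 * W'.a₁ ^ 2 * W'.a₃ * P x ^ 2 * P y * P z * Q x
      - 3 * W'.a₁ ^ 2 * W'.a₃ * W'.a₆ * P z ^ 4 * Q y
      - 3 * W'.a₁ ^ 2 * W'.a₃ * W'.a₆ * P y * P z ^ 3 * Q z
      - W'.a₁ ^ 2 * W'.a₃ * W'.a₄ * P y * P z ^ 3 * Q x
      - 4 * W'.a₁ ^ 2 * W'.a₃ * W'.a₄ * P x * P z ^ 3 * Q y
      - 4 * W'.a₁ ^ 2 * W'.a₃ * W'.a₄ * P x * P y * P z ^ 2 * Q z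
      + 3 * W'.a₁ ^ 2 * W'.a₃ ^ 2 * P y * P z ^ 3 * Q y
      - W'.a₁ ^ 2 * W'.a₃ ^ 2 * P y ^ 2 * P z ^ 2 * Q z
      - 3 * W'.a₁ ^ 2 * W'.a₃ ^ 2 * P x ^ 2 * P z ^ 2 * Q x
      + W'.a₁ ^ 2 * W'.a₃ ^ 2 * W'.a₄ * P z ^ 4 * Q x
      + W'.a₁ ^ 2 * W'.a₃ ^ 2 * W'.a₄ * P x * P z ^ 3 * Q z
      - W'.a₁ ^ 2 * W'.a₃ ^ 3 * P y * P z ^ 3 * Q z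
      - 4 * W'.a₁ ^ 2 * W'.a₂ * P x * P y ^ 2 * P z * Q x
      - 3 * W'.a₁ ^ 2 * W'.a₂ * P x ^ 2 * P y * P z * Q y
      + 3 * W'.a₁ ^ 2 * W'.a₂ * W'.a₆ * P x ^ 2 * P z ^ 2 * Q z
      + W'.a₁ ^ 2 * W'.a₂ * W'.a₄ * P y ^ 2 * P z ^ 2 * Q z
      + 2 * W'.a₁ ^ 2 * W'.a₂ * W'.a₄ * P x ^ 2 * P z ^ 2 * Q x
      - W'.a₁ ^ 2 * W'.a₂ * W'.a₄ * W'.a₆ * P z ^ 4 * Q z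
      - W'.a₁ ^ 2 * W'.a₂ * W'.a₄ ^ 2 * P x * P z ^ 3 * Q z
      - 5 * W'.a₁ ^ 2 * W'.a₂ * W'.a₃ * P x * P y * P z ^ 2 * Q x
      - 3 * W'.a₁ ^ 2 * W'.a₂ * W'.a₃ * P x ^ 2 * P z ^ 2 * Q y
      + W'.a₁ ^ 2 * W'.a₂ * W'.a₃ * W'.a₄ * P y * P z ^ 3 * Q z
      + W'.a₁ ^ 2 * W'.a₂ * W'.a₃ ^ 2 * P x ^ 2 * P z ^ 2 * Q z
      + W'.a₁ ^ 2 * W'.a₂ ^ 2 * P y ^ 2 * P z ^ 2 * Q x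
      - W'.a₁ ^ 2 * W'.a₂ ^ 2 * P x * P y * P z ^ 2 * Q y
      - W'.a₁ ^ 2 * W'.a₂ ^ 2 * W'.a₆ * P z ^ 4 * Q x
      - W'.a₁ ^ 2 * W'.a₂ ^ 2 * W'.a₄ * P x * P z ^ 3 * Q x
      - W'.a₁ ^ 2 * W'.a₂ ^ 2 * W'.a₄ * P x ^ 2 * P z ^ 2 * Q z
      + W'.a₁ ^ 2 * W'.a₂ ^ 2 * W'.a₃ * P y * P z ^ 3 * Q x
      - W'.a₁ ^ 2 * W'.a₂ ^ 3 * P x ^ 2 * P z ^ 2 * Q x + 5 * W'.a₁ ^ 3 * P x * P y ^ 2 * P z * Q y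
      - 3 * W'.a₁ ^ 3 * W'.a₆ * P x * P y * P z ^ 2 * Q z
      - W'.a₁ ^ 3 * W'.a₄ * P x * P y * P z ^ 2 * Q x - W'.a₁ ^ 3 * W'.a₄ * P x ^ 2 * P z ^ 2 * Q y
      - W'.a₁ ^ 3 * W'.a₄ * P x ^ 2 * P y * P z * Q z - W'.a₁ ^ 3 * W'.a₃ * P y ^ 2 * P z ^ 2 * Q x
      + 4 * W'.a₁ ^ 3 * W'.a₃ * P x * P y * P z ^ 2 * Q y
      + W'.a₁ ^ 3 * W'.a₃ * W'.a₄ * P x * P z ^ 3 * Q x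
      - W'.a₁ ^ 3 * W'.a₃ ^ 2 * P y * P z ^ 3 * Q x
      - W'.a₁ ^ 3 * W'.a₃ ^ 2 * P x * P y * P z ^ 2 * Q z
      - W'.a₁ ^ 3 * W'.a₂ * P y ^ 2 * P z ^ 2 * Q y - W'.a₁ ^ 3 * W'.a₂ * P x ^ 2 * P y * P z * Q x
      + W'.a₁ ^ 3 * W'.a₂ * W'.a₆ * P z ^ 4 * Q y + W'.a₁ ^ 3 * W'.a₂ * W'.a₄ * P x * P z ^ 3 * Q y
      + W'.a₁ ^ 3 * W'.a₂ * W'.a₄ * P x * P y * P z ^ 2 * Q z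
      - W'.a₁ ^ 3 * W'.a₂ * W'.a₃ * P y * P z ^ 3 * Q y
      + W'.a₁ ^ 3 * W'.a₂ * W'.a₃ * P x ^ 2 * P z ^ 2 * Q x
      + W'.a₁ ^ 3 * W'.a₂ ^ 2 * P x * P y * P z ^ 2 * Q x
      + W'.a₁ ^ 3 * W'.a₂ ^ 2 * P x ^ 2 * P z ^ 2 * Q y + W'.a₁ ^ 4 * P x ^ 2 * P y * P z * Q y
      - W'.a₁ ^ 4 * W'.a₃ * P x * P y * P z ^ 2 * Q x
      - W'.a₁ ^ 4 * W'.a₂ * P x * P y * P z ^ 2 * Q y) * (equation_iff Q).mp hQ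

end WeierstrassCurve.Projective
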